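import Summits.HodgeConjecture.CorCM.MumfordTateRankSimpleThreefolds
import Summits.HodgeConjecture.CorCM.MumfordTateRankSurfaces
import Summits.HodgeConjecture.CorCM.MumfordTateRankTrivialEndomorphisms
import Literature.AlgebraicGeometry.HodgeTheory.AbelianThreefoldsStablyNondegenerate
import HarnessLib

/-!
# Every complex abelian THREEFOLD: `dim MT(H¹X) ≤ 14` unless `X` is simple; `t = 22 ⟺ End⁰X = ℚ`; no rank in `15 … 21`

COR-CM (cell `pub-hodgecm2`, seat `b27` gen 46, count-neutral Mumford–Tate-rank ladder; theorems only, no definition, no named fact;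
UNCONDITIONAL — nothing here uses or asserts HC_CM).  Sequel of `CorCM/MumfordTateRankSimpleThreefolds` (simple threefolds: `t ∈ {4, 10, 22}`).
A NON-simple threefold is isogenous to `E × S` (curve × surface, Poincaré; `HodgeTheory/AbelianThreefoldsStablyNondegenerate`), so the
subadditivity `t(X) + 1 ≤ t(E) + t(S)` (`CorCM/MumfordTateRankSubadditive`) with `t(E) ≤ 4` (`Lie Hg ⊆ 𝔰𝔭₂`) and `t(S) ≤ 11` (the surface table
`CorCM/MumfordTateRankSurfaces`) bounds its rank:

* **`mtRank_hodge_one_le_fourteen_of_not_isSimple_threefold`** — a non-simple abelian threefold has `t ≤ 14`;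
* **`mtRank_hodge_one_le_fourteen_or_eq_twentytwo_of_threefold`** — every abelian threefold has `t ≤ 14` or `t = 22` (the ranks `15, …, 21` do
  not occur; `t ≤ 22` is the symplectic bound `3·7 + 1`);
* **`isSimple_of_threefold_of_fourteen_lt_mtRank`** — `t > 14 ⟹ X` simple with `End⁰X = ℚ` and `t = 22`;
* **`mtRank_hodge_one_eq_twentytwo_iff_of_threefold`** — **for EVERY abelian threefold: `t = 22 ⟺ dim_ℚ End⁰X = 1`** (the threefold analogue of the
  surface statement `t = 11 ⟺ dim End⁰ = 1`).

## References
* [MoonenZarhin1999LowDim] B. Moonen, Yu. G. Zarhin, Math. Ann. 315 (1999), §2 (2.2)–(2.3), §3 (3.2).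
* [MumfordAV1970] D. Mumford, *Abelian Varieties*, §19 Thm. 1 (Poincaré's complete reducibility).
* [Deligne1982HodgeCycles] P. Deligne, LNM 900 (1982), I §3.1 and Prop. 3.4, 3.6.
-/

noncomputable section

open scoped TensorProduct
open CategoryTheory Module

namespace Summit.HodgeConjecture.CorCM

open Literature.AlgebraicGeometry.Motives
open Literature.AlgebraicGeometry.Motives.AbelianVariety
open Literature.AlgebraicGeometry.Motives.HodgeStructure
open Literature.AlgebraicGeometry.HodgeTheory

variable [HodgeTensorFacts.{0, 0}] {X : AbelianVariety ℂ}

/-- **A NON-simple complex abelian threefold has `dim MT(H¹X) ≤ 14`**: `X ∼ E × S` with `E` a curve and `S` a surface, and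
`t(X) + 1 ≤ t(E) + t(S) ≤ 4 + 11`. [cite: MoonenZarhin1999LowDim, §2 (2.2) and §3] [cite: MumfordAV1970, §19 Thm. 1] -/
theorem mtRank_hodge_one_le_fourteen_of_not_isSimple_threefold {n : ℕ} (hX : IsSmoothProjective n X.X) (hX3 : X.dim = 3)
    (hns : ¬ X.IsSimple) :
    haveI := BettiUniverse.finite hX 1
    (BettiUniverse.hodge exists_isReal_hodgeModel_holds hX 1).mtRank ≤ 14 := by
  haveI := BettiUniverse.finite hX 1
  obtain ⟨E, S, hE1, hS2, hES⟩ := exists_curve_prod_surface_isIsogenous_of_not_isSimple_threefold hX3 hns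
  have hE : IsSmoothProjective E.dim E.X := AbelianVariety.isSmoothProjective_holds
  have hS : IsSmoothProjective S.dim S.X := AbelianVariety.isSmoothProjective_holds
  haveI := BettiUniverse.finite hE 1
  haveI := BettiUniverse.finite hS 1
  have hsub := mtRank_hodge_one_add_one_le_add_of_isIsogenous_prod hE hS (by omega) (by omega) hX (IsIsogenous.symm' hES)
  have hEle : (BettiUniverse.hodge exists_isReal_hodgeModel_holds hE 1).mtRank ≤ 4 := by
    have h := mtRank_hodge_one_le_symplectic hE (by omega)
    have h4 : E.dim * (2 * E.dim + 1) + 1 = 4 := by rw [hE1]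
    omega
  have hSle : (BettiUniverse.hodge exists_isReal_hodgeModel_holds hS 1).mtRank ≤ 11 := by
    rcases mtRank_hodge_one_mem_of_surface hS hS2 with h | h | h | h | h | h <;> omega
  omega

/-- **Every complex abelian threefold has `dim MT(H¹X) ≤ 14` or `dim MT(H¹X) = 22`** — the ranks `15, …, 21` do not occur in dimension three
(simple: `t ∈ {4, 10, 22}`; non-simple: `t ≤ 14`). [cite: MoonenZarhin1999LowDim, §2 (2.3) and §3] -/
theorem mtRank_hodge_one_le_fourteen_or_eq_twentytwo_of_threefold {n : ℕ} (hX : IsSmoothProjective n X.X) (hX3 : X.dim = 3) :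
    haveI := BettiUniverse.finite hX 1
    (BettiUniverse.hodge exists_isReal_hodgeModel_holds hX 1).mtRank ≤ 14 ∨
      (BettiUniverse.hodge exists_isReal_hodgeModel_holds hX 1).mtRank = 22 := by
  by_cases hs : X.IsSimple
  · rcases mtRank_hodge_one_mem_of_isSimple_threefold hX hs hX3 with h | h | h
    · exact Or.inl (by omega)
    · exact Or.inl (by omega)
    · exact Or.inr h
  · exact Or.inl (mtRank_hodge_one_le_fourteen_of_not_isSimple_threefold hX hX3 hs)

/-- **`dim MT(H¹X) ≤ 22` for every abelian threefold** (the symplectic bound `3 · 7 + 1`). [cite: Deligne1982HodgeCycles, I §3 Prop. 3.6] -/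
theorem mtRank_hodge_one_le_twentytwo_of_threefold {n : ℕ} (hX : IsSmoothProjective n X.X) (hX3 : X.dim = 3) :
    haveI := BettiUniverse.finite hX 1
    (BettiUniverse.hodge exists_isReal_hodgeModel_holds hX 1).mtRank ≤ 22 := by
  have h := mtRank_hodge_one_le_symplectic hX (by omega)
  rw [hX3] at h
  exact h

/-- **`dim MT(H¹X) > 14` forces a threefold to be SIMPLE with `End⁰X = ℚ` and `t = 22`.** [cite: MoonenZarhin1999LowDim, §2 (2.3) and §3] -/
theorem isSimple_of_threefold_of_fourteen_lt_mtRank {n : ℕ} (hX : IsSmoothProjective n X.X) (hX3 : X.dim = 3)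
    (h14 : haveI := BettiUniverse.finite hX 1; 14 < (BettiUniverse.hodge exists_isReal_hodgeModel_holds hX 1).mtRank) :
    haveI := BettiUniverse.finite hX 1
    X.IsSimple ∧ Module.finrank ℚ X.endAlgebra = 1 ∧ (BettiUniverse.hodge exists_isReal_hodgeModel_holds hX 1).mtRank = 22 := by
  haveI := BettiUniverse.finite hX 1
  have hs : X.IsSimple := by
    by_contra hns
    have h := mtRank_hodge_one_le_fourteen_of_not_isSimple_threefold hX hX3 hns
    omega
  have h22 : (BettiUniverse.hodge exists_isReal_hodgeModel_holds hX 1).mtRank = 22 := by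
    rcases mtRank_hodge_one_mem_of_isSimple_threefold hX hs hX3 with h | h | h <;> omega
  exact ⟨hs, ((mtRank_hodge_one_iff_of_isSimple_threefold hX hs hX3).1).1 h22, h22⟩

/-- **For EVERY complex abelian threefold: `dim MT(H¹X) = 22 ⟺ dim_ℚ End⁰X = 1`** (`⟸` without simplicity, `Lie Hg = 𝔰𝔭₆`; `⟹`: a rank
above `14` forces simplicity, and the simple table). [cite: MoonenZarhin1999LowDim, §2 (2.3)] -/
theorem mtRank_hodge_one_eq_twentytwo_iff_of_threefold {n : ℕ} (hX : IsSmoothProjective n X.X) (hX3 : X.dim = 3) :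
    haveI := BettiUniverse.finite hX 1
    (BettiUniverse.hodge exists_isReal_hodgeModel_holds hX 1).mtRank = 22 ↔ Module.finrank ℚ X.endAlgebra = 1 :=
  ⟨fun h => (isSimple_of_threefold_of_fourteen_lt_mtRank hX hX3 (by rw [h]; norm_num)).2.1,
    fun h => (mtRank_hodge_one_eq_twentytwo_of_threefold_of_finrank_endAlgebra_eq_one hX hX3 h).1⟩

/-- **An abelian threefold with `End⁰X = ℚ` is simple** (its rank `22` exceeds every non-simple rank). [cite: MoonenZarhin1999LowDim, §2 (2.3)] -/
theorem isSimple_of_threefold_of_finrank_endAlgebra_eq_one (hX3 : X.dim = 3) (hE1 : Module.finrank ℚ X.endAlgebra = 1) : X.IsSimple :=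
  (isSimple_of_threefold_of_fourteen_lt_mtRank (AbelianVariety.isSmoothProjective_holds (A := X)) hX3
    (by rw [(mtRank_hodge_one_eq_twentytwo_of_threefold_of_finrank_endAlgebra_eq_one
      (AbelianVariety.isSmoothProjective_holds (A := X)) hX3 hE1).1]; norm_num)).1

end Summit.HodgeConjecture.CorCM

end
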